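import Mathlib

/-!
# Sketch — crux-ideate `stmt-HodgeConjecture-13674` (TwinSimilitudeAlgebraic), round 1, ideator 1

First lemmas of the two crux idea cards, stated (and proved) over abstract `ℚ`-vector spaces with
bilinear forms — the linear-algebra skeleton that the geometric statements instantiate with
`V = H²(S(ℂ);ℚ)`, `V' = H²(S'(ℂ);ℚ)`, `B, B'` the cup forms, `ψ` the rational Hodge 2-similitude of
the crux, `W = H²(Σ;ℚ)` for a double cover `π : Σ → S`.

* Card `square-the-similitude`: `tensorSquare_similitude`, `tensorSquare_half_isometry`
  (the tensor square of a 2-similitude, halved, is an ISOMETRY of the tensor-square forms) and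
  `contr_tensorSquare` (extraction of `ψ` from `ψ ⊗ ψ` by contraction against a class `g`).
* Card `double-cover-isometrizer`: `doubleCover_isometrizer` (pull-back to a double cover composed
  with a 2-similitude multiplies forms by 4, i.e. is an isometric embedding after halving, and
  `π_* ∘ π^* = 2` extracts `2ψ`).
-/

namespace Summit.HodgeConjecture.HodgeConjecture.Cruxes.TwinSimilitudeAlgebraic.IdeaSketch1

open scoped TensorProduct
open LinearMap (BilinForm)

variable {V V' W : Type*} [AddCommGroup V] [Module ℚ V] [AddCommGroup V'] [Module ℚ V']
  [AddCommGroup W] [Module ℚ W]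

/-- **Card A, first lemma (isometrisation by squaring).** If `ψ : V' → V` is a 2-similitude from
`(V', B')` to `(V, B)`, then `ψ ⊗ ψ` multiplies the tensor-square forms `B ⊗ B`, `B' ⊗ B'` by
`4 = 2²`, a square. -/
theorem tensorSquare_similitude (B : BilinForm ℚ V) (B' : BilinForm ℚ V') (ψ : V' →ₗ[ℚ] V)
    (hψ : ∀ x y, B (ψ x) (ψ y) = 2 * B' x y) (u v : V' ⊗[ℚ] V') :
    (B.tmul B) (TensorProduct.map ψ ψ u) (TensorProduct.map ψ ψ v) = 4 * (B'.tmul B') u v := by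
  induction u using TensorProduct.induction_on with
  | zero => simp
  | tmul x x' =>
    induction v using TensorProduct.induction_on with
    | zero => simp
    | tmul y y' =>
      simp only [TensorProduct.map_tmul, LinearMap.BilinForm.tmul,
        LinearMap.BilinForm.tensorDistrib_tmul, hψ, smul_eq_mul]
      ring
    | add v₁ v₂ h₁ h₂ => simp only [map_add, h₁, h₂, mul_add]
  | add u₁ u₂ h₁ h₂ => simp only [map_add, LinearMap.add_apply, h₁, h₂, mul_add]

/-- Hence `(ψ ⊗ ψ)/2` is an honest ISOMETRY `(V' ⊗ V', B' ⊗ B') → (V ⊗ V, B ⊗ B)`: the multiplier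
class `[2] ∈ ℚˣ/ℚˣ²` of the crux dies in the tensor square (weight 4). -/
theorem tensorSquare_half_isometry (B : BilinForm ℚ V) (B' : BilinForm ℚ V') (ψ : V' →ₗ[ℚ] V)
    (hψ : ∀ x y, B (ψ x) (ψ y) = 2 * B' x y) (u v : V' ⊗[ℚ] V') :
    (B.tmul B) (((1 / 2 : ℚ) • TensorProduct.map ψ ψ) u) (((1 / 2 : ℚ) • TensorProduct.map ψ ψ) v)
      = (B'.tmul B') u v := by
  simp only [LinearMap.smul_apply, map_smul, LinearMap.smul_apply, smul_eq_mul,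
    tensorSquare_similitude B B' ψ hψ]
  ring

/-- Contraction of the second tensor factor against a fixed class `g` via `B`:
`a ⊗ b ↦ B(b, g) • a` (geometrically: cup with `pr₂^* g` and push forward along `pr₁`, an
algebraic operation when `g` is a divisor class). -/
noncomputable def contr (B : BilinForm ℚ V) (g : V) : V ⊗[ℚ] V →ₗ[ℚ] V :=
  (TensorProduct.rid ℚ V).toLinearMap ∘ₗ TensorProduct.map LinearMap.id (B.flip g)

theorem contr_tmul (B : BilinForm ℚ V) (g a b : V) : contr B g (a ⊗ₜ b) = B b g • a := by
  simp [contr]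

/-- **Card A, extraction identity.** Applying `ψ ⊗ ψ` to `x ⊗ h'` and contracting against `g`
returns `B(ψ h', g) • ψ x`: so whenever `B(ψ h', g) ≠ 0` (e.g. `h'`, `g` ample classes),
`ψ = B(ψ h', g)⁻¹ • contr_g ∘ (ψ ⊗ ψ) ∘ (– ⊗ h')` is a composite of `ψ ⊗ ψ` with algebraic
operations — `ψ` is algebraic as soon as `ψ ⊗ ψ` (equivalently `(ψ ⊗ ψ)/2`) is. -/
theorem contr_tensorSquare (B : BilinForm ℚ V) (ψ : V' →ₗ[ℚ] V) (g : V) (x h' : V') :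
    contr B g (TensorProduct.map ψ ψ (x ⊗ₜ h')) = B (ψ h') g • ψ x := by
  simp [contr, TensorProduct.map_tmul]

theorem extract_of_tensorSquare (B : BilinForm ℚ V) (ψ : V' →ₗ[ℚ] V) (g : V) (x h' : V')
    (hne : B (ψ h') g ≠ 0) :
    ψ x = (B (ψ h') g)⁻¹ • contr B g (TensorProduct.map ψ ψ (x ⊗ₜ h')) := by
  rw [contr_tensorSquare, smul_smul, inv_mul_cancel₀ hne, one_smul]

/-- **Card B, first lemma (double covers isometrise).** `pullb = π^*` doubles the form
(`deg π = 2`), `ψ` is a 2-similitude; then `j := π^* ∘ ψ` multiplies forms by `4` — so `j/2` is an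
ISOMETRIC embedding of `(V', B')` into `(W, B_W)` — and `π_* ∘ π^* = 2` gives `π_* ∘ j = 2ψ`
(so `ψ` is algebraic iff `j` is, `π_*` and `π^*` being graphs of a morphism). -/
theorem doubleCover_isometrizer (BW : BilinForm ℚ W) (B : BilinForm ℚ V) (B' : BilinForm ℚ V')
    (pullb : V →ₗ[ℚ] W) (pushf : W →ₗ[ℚ] V) (ψ : V' →ₗ[ℚ] V)
    (hpull : ∀ x y, BW (pullb x) (pullb y) = 2 * B x y)
    (hψ : ∀ x y, B (ψ x) (ψ y) = 2 * B' x y)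
    (hproj : pushf ∘ₗ pullb = (2 : ℚ) • LinearMap.id) :
    (∀ a b, BW ((pullb ∘ₗ ψ) a) ((pullb ∘ₗ ψ) b) = 4 * B' a b) ∧
      pushf ∘ₗ (pullb ∘ₗ ψ) = (2 : ℚ) • ψ := by
  refine ⟨fun a b => ?_, ?_⟩
  · simp only [LinearMap.comp_apply, hpull, hψ]
    ring
  · rw [← LinearMap.comp_assoc, hproj]
    ext a
    simp

/-- The isometric embedding of Card B, normalised: `(j/2)` with `j = π^* ∘ ψ` is an isometry
`(V', B') → (W, B_W)`. -/
theorem doubleCover_half_isometry (BW : BilinForm ℚ W) (B : BilinForm ℚ V) (B' : BilinForm ℚ V')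
    (pullb : V →ₗ[ℚ] W) (ψ : V' →ₗ[ℚ] V)
    (hpull : ∀ x y, BW (pullb x) (pullb y) = 2 * B x y)
    (hψ : ∀ x y, B (ψ x) (ψ y) = 2 * B' x y) (a b : V') :
    BW (((1 / 2 : ℚ) • (pullb ∘ₗ ψ)) a) (((1 / 2 : ℚ) • (pullb ∘ₗ ψ)) b) = B' a b := by
  simp only [LinearMap.smul_apply, LinearMap.comp_apply, map_smul, smul_eq_mul, hpull, hψ]
  ring

end Summit.HodgeConjecture.HodgeConjecture.Cruxes.TwinSimilitudeAlgebraic.IdeaSketch1
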